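import Summits.HodgeConjecture.HodgeConjecture.Theorems.Q8SymplecticPowersRegularOfNodalBranchCurve
import Literature.AlgebraicGeometry.HodgeTheory.QuaternionicQuarticFermatMemberExact
import HarnessLib

/-!
# Route `Q8SymplecticPowers`, crux K1Q (stmt-HodgeConjecture-24190), line `mechanism-v2`: stub S1 `stub_regularVeryGeneralQ`
# FROM THE PRINT FACT S1b + «the nodal locus contains a non-empty basic open set of parameters»

Helper file (`--supports stmt-HodgeConjecture-24190 --as helper`; nothing here closes an item). Sorry-free; axioms standard; no
definition; ONE named fact as hypothesis (S1b = `hirzebruchTwo_nodalDoubleCover_bettiOne_eq_zero`, p828133). Written by the prover seat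
`leafhand-hodge-q8symplecticpowers-4` (g5, ninth hand). Sequel of `Q8SymplecticPowersRegularOfNodalBranchCurve` (p828224: S1 ⟸ S1b ∧ hNod).

With the explicit Fermat member now known to satisfy the whole nodality package (`Q8Family.fermatParam_nodalPackage`, p828799:
the nodal locus is NON-EMPTY for every even `e ≥ 4`), the density hypothesis `hNod` of p828224 («a nodal parameter off every
hypersurface `g = 0`») follows from OPENNESS in its weakest usable form:

  `hOpen` : for every even `e ≥ 4` there is `0 ≠ h ∈ ℂ[a]` such that every parameter `a` with `h(a) ≠ 0` satisfies the nodality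
  package (exact chart data `(α, N)`, `α` even `≥ 2`, and the branch form `G₂ = planeG₂ a (a₀² − a₁²)⁻¹` nodal in the four charts of `𝔽₂`).

* `exists_eval_ne_zero` — a non-zero complex polynomial has a non-root (Mathlib `MvPolynomial.funext`);
* `stub_regularVeryGeneralQ_of_nodalBasicOpen` — **S1 VERBATIM from S1b and `hOpen`** (pick `a ∉ V(g·h)`); non-emptiness of the
  nodal locus is the tree's `Q8Family.fermatParam_nodalPackage` (p828799).

So the S1 residue is: S1b (print, typed) + `hOpen` [L: the bad set is the image of a closed incidence in `𝔽₂ × 𝔸ᴺ` (chart-wise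
`F = ∂F = 0 ∧ hessDet F = 0`) under a proper projection, hence closed — `Motives.isProper_projectiveSpace` on the `ℙ²_u` model — and
it misses `fermatParam e` by p828799]. Honest scope: a conditional reduction; S1, K1Q, HC are NOT proved here.
-/

set_option linter.dupNamespace false
set_option maxHeartbeats 400000

noncomputable section

open CategoryTheory AlgebraicGeometry MvPolynomial
open Literature.AlgebraicGeometry Literature.AlgebraicGeometry.Motives Literature.AlgebraicGeometry.HodgeTheory
open Literature.AlgebraicGeometry.HodgeTheory.BettiUniverse Literature.AlgebraicGeometry.HodgeTheory.Q8Family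
open Literature.AlgebraicGeometry.PlaneCurves.AffineNodalCurves Literature.AlgebraicGeometry.Surfaces.HirzebruchTwoDoublePlane

namespace Summit.HodgeConjecture.HodgeConjecture.Theorems.Q8SymplecticPowersRegularOfNodalBasicOpen

/-- A non-zero polynomial over `ℂ` has a non-root. [cite: Hartshorne1977, I Ex. 1.1 / I.1 (an infinite field: a polynomial
vanishing everywhere is zero)] -/
theorem exists_eval_ne_zero {ι : Type} (p : MvPolynomial ι ℂ) (hp : p ≠ 0) : ∃ a : ι → ℂ, MvPolynomial.eval a p ≠ 0 := by
  by_contra h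
  simp only [ne_eq, not_exists, not_not] at h
  exact hp (MvPolynomial.funext fun a => by rw [h a, map_zero])

/-- **S1 VERBATIM from the print fact S1b and a non-empty basic open set of nodal parameters.** [cite: BarthPetersVandeVen1984,
V §22 (invariants of double coverings)] [cite: Zariski1929] [cite: VoisinHodgeI2002, §9.1.1 Thm. 9.3] -/
theorem stub_regularVeryGeneralQ_of_nodalBasicOpen
    (hS1b : hirzebruchTwo_nodalDoubleCover_bettiOne_eq_zero)
    (hOpen : ∀ ⦃e : ℕ⦄, Even e → 4 ≤ e → ∃ h : ParamRing e, h ≠ 0 ∧ ∀ a : CIdx e → ℂ, MvPolynomial.eval a h ≠ 0 →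
      ∃ α N : ℕ, Even α ∧ 2 ≤ α ∧
        IsChartExact α N (planeG₂ a (coefLin a 0 ^ 2 - coefLin a 1 ^ 2)⁻¹) ∧
        IsNodal (planeG₂ a (coefLin a 0 ^ 2 - coefLin a 1 ^ 2)⁻¹) ∧
        IsNodal (X 0 ^ (N % 2) * chartTwo N (planeG₂ a (coefLin a 0 ^ 2 - coefLin a 1 ^ 2)⁻¹)) ∧
        IsNodal (chartThree α (planeG₂ a (coefLin a 0 ^ 2 - coefLin a 1 ^ 2)⁻¹)) ∧
        IsNodal (X 0 ^ (N % 2) * chartFour α N (planeG₂ a (coefLin a 0 ^ 2 - coefLin a 1 ^ 2)⁻¹))) :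
open Literature.AlgebraicGeometry.Motives Literature.AlgebraicGeometry.HodgeTheory Literature.AlgebraicGeometry.HodgeTheory.BettiUniverse CategoryTheory.Limits in ∀ ⦃e : ℕ⦄, Even e → 4 ≤ e → ∃ G : ℕ → MvPolynomial ({d : Fin 3 →₀ ℕ // d.degree = 1} ⊕ {d : Fin 3 →₀ ℕ // d.degree = e - 1}) ℂ, (∀ i, ∃ c ψ : MvPolynomial (Fin 3) ℂ, c.IsHomogeneous 1 ∧ ψ.IsHomogeneous (e - 1) ∧ MvPolynomial.rename (Equiv.swap (0 : Fin 3) 1) ψ = ψ ∧ MvPolynomial.eval (Sum.elim (fun d => c.coeff d.1) (fun d => ψ.coeff d.1)) (G i) ≠ 0) ∧ ∀ c ψ : MvPolynomial (Fin 3) ℂ, c.IsHomogeneous 1 → ψ.IsHomogeneous (e - 1) → MvPolynomial.rename (Equiv.swap (0 : Fin 3) 1) ψ = ψ → (∀ i, MvPolynomial.eval (Sum.elim (fun d => c.coeff d.1) (fun d => ψ.coeff d.1)) (G i) ≠ 0) → ∀ ⦃V X : SchemeOver ℂ⦄ (hX : IsSmoothProjective 2 X), IsHypersurfaceCutOutBy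 3 (MvPolynomial.X (Fin.last 3) ^ 4 * MvPolynomial.X (Fin.castSucc 2) ^ (2 * e) - MvPolynomial.rename Fin.castSucc (c * MvPolynomial.rename (Equiv.swap (0 : Fin 3) 1) c ^ 3 * ((MvPolynomial.X 0 - MvPolynomial.X 1) * ψ) ^ 2)) V → AlgebraicGeometry.Scheme.BirationalOver X.hom V.hom → Module.finrank ℚ (bettiCohomology X 1) = 0 := by
  refine Q8SymplecticPowersRegularOfNodalBranchCurve.stub_regularVeryGeneralQ_of_nodalDoubleCoverFact hS1b
    fun e he h4 g hg => ?_
  obtain ⟨h, hh, hgood⟩ := hOpen he h4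
  obtain ⟨a, ha⟩ := exists_eval_ne_zero (g * h) (mul_ne_zero hg hh)
  rw [map_mul, mul_ne_zero_iff] at ha
  exact ⟨a, ha.1, hgood a ha.2⟩

end Summit.HodgeConjecture.HodgeConjecture.Theorems.Q8SymplecticPowersRegularOfNodalBasicOpen

end
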